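import Summits.BirchSwinnertonDyer.BirchSwinnertonDyer.Theorems.GenusKolyvaginAtTwoGenusDeepSupplyAtTwoNegDiscNarrowKFourCellReading
import Summits.BirchSwinnertonDyer.BirchSwinnertonDyer.Theorems.GenusKolyvaginAtTwoGenusDeepSupplyAtTwoNegDiscNarrowKFourCellShaStructure
import Summits.BirchSwinnertonDyer.BirchSwinnertonDyer.Theorems.GenusKolyvaginAtTwoGenusDeepSupplyAtTwoNegDiscNarrowKFourCellCapitulation
import Summits.BirchSwinnertonDyer.BirchSwinnertonDyer.Theorems.GenusKolyvaginAtTwoKolyvaginRelationAtTwo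
import Summits.BirchSwinnertonDyer.BirchSwinnertonDyer.Theorems.SchneiderFreeAdditiveX3PoitouTateReciprocitySumHolds
import Summits.BirchSwinnertonDyer.Rank1Residual.GaloisImage.PropagatedConditionCardEP
import HarnessLib

/-!
# Route `GenusKolyvaginAtTwo`, crux 23491, K₄ cell (Δ<0): THE KERNEL PACKAGE MODULO PRINT ONLY — Poitou–Tate and Euler–Poincaré
# DISCHARGED by tree theorems, Q2 replaced by the one print fact Gross 3.7 (2) / Nekovář 4.9 (`prop37_2_frobeniusCongruence`, item 23091)

LEAD seat `bsd-line-gk2-p1` g23 (cell `bsd-f1-sign2`), `--supports stmt-BirchSwinnertonDyer-31526 --as helper` (K₄ = `K4Neg`).  THEOREMS ONLY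
(no definition, no named fact, no `sorry`).  **BSD is NOT proved by this file; nothing about Kolyvagin's conjecture at `2` is asserted; no item is
closed.**

WHY.  The K₄-cell package of the LEAD lineage (p765896 `…KFourCellShaTwoRank`, p766296 `…KFourCellShaStructure`, p766389 `…KFourCellInvariantClasses`,
p767174/p767500 `…KFourCellKolyvaginClass`, p767719 `…KFourCellReading`, p768636 `…KFourCellCapitulation`) carries three displayed hypotheses:
`hPT : poitouTate_selmerStructure_duality_real ℚ`, `hEP : ∀ v, localEulerPoincareCharacteristic (v.adicCompletion ℚ)` and — for the deep classes —
the route item Q2 `KolyvaginRelationAtTwo`.  ALL THREE are settled elsewhere in the tree: `hPT` by cell bsd-schneider's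
`SchneiderFreeAdditiveX3.PoitouTateReduction.poitouTate_selmerStructure_duality_real_holds ℚ` (p626891; Milne *ADT* I 4.10(b) + Howard 2.1.11, kernel
proof), `hEP` by b2b-bsdres' `Rank1Residual.GaloisImage.EP.forall_localEulerPoincareCharacteristic_adicCompletion ℚ` (Tate's local Euler–Poincaré
characteristic, kernel proof), and Q2 modulo the PRINT fact `GrossLMS1991.prop37_2_frobeniusCongruence` (= the signature of item 23091; Gross 1991
Prop. 3.7 (2), Nekovář 2007 Prop. 4.9) by gk2-p2 g5–g7 `GenusExact.kolyvaginRelationAtTwo_of_frobeniusCongruence` (McCallum 4.4 at EVERY `p`).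
This file RE-ISSUES the package with those inputs plugged in:

* §1 UNCONDITIONAL structure of the K₄ cell: `natCard_shaTorsionBy_two_baseChange_eq_four_of_cell'` (`#Ш(E_K)[2] = 4`, `#Sel₂(E_K) = 8`),
  `exists_addEquiv_sha_primary_zmod_sq_of_cell'` (`Ш(E_K)[2^∞] ≃ (ℤ/2^e)²`), `existsUnique_mem_selmerGroup_resTorsion_eq_of_cell'` (unique
  descent of `σ₀`-invariant `2`-Selmer classes of `E_K` to `Sel₂(E/ℚ)`), `existsUnique_resTorsion_eq_kummer_of_depth_pos_of_cell'` (the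
  capitulating class `s_y` of `y_K/2^{M₀}`) — NO print hypothesis left (the remaining binders are the cell: `Δ<0`, `#Sel₂(E) = 4`, prime Heegner
  frame with `2` split, twin `#Sel₂(Wd) = 2`, `E(K)[2] = 0`, and, for the counts, `rank E(K) = 1` with `Ш(E_K)[2^∞]` finite).
* §2 MODULO ONE PRINT FACT (`prop37_2_frobeniusCongruence`): `exists_compatible_datum_kolyvaginClass_two_descends_of_cell_of_frobeniusCongruence` —
  at EVERY Kolyvagin prime `ℓ` at `2` on the `M₀ ≥ 1` cell there is a McCallum-compatible datum `d` of conductor `ℓ` whose class `c₁(ℓ)` is `res_K s(ℓ)`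
  for a UNIQUE `s(ℓ)`, `s(ℓ) ∈ Sel₂(E/ℚ)`, and `c₁(ℓ) ≠ 0 ⟺ P(ℓ) ∉ 2E(K[ℓ])` (p767719 with `hQ2 := kolyvaginRelationAtTwo_of_frobeniusCongruence h37`,
  `hPT`, `hEP` := the tree theorems).  The gate records this as a `conditional-result` on the PRINT fact only.

NET READING (LEAD-BRIEF-g23 §2): modulo Gross 3.7 (2) ALONE, K₄′ at a deep prime `ℓ` ⟺ «`s(ℓ) ≠ 0`», and by p768636 §4 `s(ℓ) ∈ {s_y} ⊔ {s′, s″}`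
according as `P(ℓ) ≡ y_K/2^{M₀}` or not (mod `2E(K[ℓ])`).  What remains beyond print is exactly Kolyvagin's conjecture at `2` on the cell.
References: [MilneADT2006] I Thm. 2.8, Thm. 4.10(b); [Howard2004HeegnerKolyvagin] Thm. 2.1.11; [GrossLMS1991] Prop. 3.7 (2), §4 (4.4), Prop. 6.2, §11;
[McCallumLMS1991] §4 Prop. 4.4, Cor. 4.5, §5 Lemma 5.1; [Nekovar2007] Prop. 4.9; [Kramer1981] Thm. 1; [SilvermanAEC2009] X.4.2.
-/

set_option linter.dupNamespace false -- `Summit.<P>.<Sub>` repeats `BirchSwinnertonDyer` (D-0017)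
set_option autoImplicit false

noncomputable section

open scoped Classical NumberField

namespace Summit.BirchSwinnertonDyer.BirchSwinnertonDyer.Theorems.GenusSupplyNarrow.KFourCell

open WeierstrassCurve NumberField IsDedekindDomain Field Function
open Literature.NumberTheory.EllipticCurves Literature.NumberTheory.GaloisRepresentations
open Literature.NumberTheory.GaloisCohomology Literature.NumberTheory.EllipticCurves.ModularForms
open Literature.NumberTheory.EllipticCurves.GrossLMS1991 (prop37_2_frobeniusCongruence)
open Summit.BirchSwinnertonDyer.BirchSwinnertonDyer.Theorems.SchneiderFreeAdditiveX3 (PoitouTateReduction.poitouTate_selmerStructure_duality_real_holds)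
open Summit.BirchSwinnertonDyer.Rank1Residual.GaloisImage (EP.forall_localEulerPoincareCharacteristic_adicCompletion)
open Summit.BirchSwinnertonDyer.Rank1Residual.X11b

variable (W : WeierstrassCurve ℚ) [W.IsElliptic] [W.IsGloballyMinimal] (K : Type) [Field K] [NumberField K]

/-! ## §1 The K₄ cell structure and descents, UNCONDITIONAL (Poitou–Tate / Euler–Poincaré from the tree) -/

/-- **`#Ш(E_K/K)[2] = 4` and `#Sel₂(E_K/K) = 8` on the K₄ cell — UNCONDITIONAL** (p765896 `natCard_shaTorsionBy_two_baseChange_eq_four` with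
`hPT`, `hEP` discharged by `poitouTate_selmerStructure_duality_real_holds ℚ` and `EP.forall_localEulerPoincareCharacteristic_adicCompletion ℚ`).
Remaining binders: the cell, `E(K)[2] = 0`, `rank E(K) = 1`, `Ш(E_K)[2^∞]` finite.  BSD is NOT proved by this.
[cite: Kramer1981, Thm. 1] [cite: SilvermanAEC2009, Thm. X.4.2] [cite: MilneADT2006, Ch. I Thm. 2.8, Thm. 4.10] -/
theorem natCard_shaTorsionBy_two_baseChange_eq_four_of_cell'
    (hΔ : W.Δ < 0) (h4 : Nat.card (W.selmerGroup 2) = 4) (hK : IsImaginaryQuadratic K) (hodd : Odd (discr K))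
    (hH : SatisfiesHeegnerHypothesis (W.conductorNorm ℤ) K) (h2K : ((Ideal.span {(2 : ℤ)}).primesOver (𝓞 K)).ncard = 2)
    {ℓ₀ : ℕ} [Fact ℓ₀.Prime] (hd : discr K = -(ℓ₀ : ℤ))
    (Wd : WeierstrassCurve ℚ) [Wd.IsElliptic] (hWd : ∃ C : VariableChange ℚ, C • W.quadraticTwist (discr K : ℚ) = Wd)
    (hSel : Nat.card (Wd.selmerGroup 2) = 2)
    (hL : ∀ P : (W.baseChange K).toAffine.Point, ((2 : ℕ) : ℤ) • P = 0 → P = 0)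
    (hrk : (W.baseChange K).mordellWeilRank = 1)
    [Finite (AddCommGroup.primaryComponent (W.baseChange K).sha 2)] :
    Nat.card (AddSubgroup.torsionBy (W.baseChange K).sha ((2 : ℕ) : ℤ)) = 4 ∧
      Nat.card (selmerGroup (W.baseChange K) ((2 : ℕ) : ℤ)) = 8 :=
  natCard_shaTorsionBy_two_baseChange_eq_four W K (PoitouTateReduction.poitouTate_selmerStructure_duality_real_holds ℚ)
    (EP.forall_localEulerPoincareCharacteristic_adicCompletion ℚ) hΔ h4 hK hodd hH h2K hd Wd hWd hSel hL hrk

/-- **`Ш(E_K/K)[2^∞] ≃ ℤ/2^e × ℤ/2^e` on the K₄ cell — UNCONDITIONAL** (p766296 `exists_addEquiv_sha_primary_zmod_sq_of_cell` with `hPT`, `hEP` discharged).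
BSD is NOT proved by this. [cite: Cassels1962ArithmeticIV] [cite: Kramer1981, Thm. 1] [cite: MilneADT2006, Ch. I Thm. 2.8, Thm. 4.10] -/
theorem exists_addEquiv_sha_primary_zmod_sq_of_cell'
    (hΔ : W.Δ < 0) (h4 : Nat.card (W.selmerGroup 2) = 4) (hK : IsImaginaryQuadratic K) (hodd : Odd (discr K))
    (hH : SatisfiesHeegnerHypothesis (W.conductorNorm ℤ) K) (h2K : ((Ideal.span {(2 : ℤ)}).primesOver (𝓞 K)).ncard = 2)
    {ℓ₀ : ℕ} [Fact ℓ₀.Prime] (hd : discr K = -(ℓ₀ : ℤ))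
    (Wd : WeierstrassCurve ℚ) [Wd.IsElliptic] (hWd : ∃ C : VariableChange ℚ, C • W.quadraticTwist (discr K : ℚ) = Wd)
    (hSel : Nat.card (Wd.selmerGroup 2) = 2)
    (hL : ∀ P : (W.baseChange K).toAffine.Point, ((2 : ℕ) : ℤ) • P = 0 → P = 0)
    (hrk : (W.baseChange K).mordellWeilRank = 1)
    [Finite (AddCommGroup.primaryComponent (W.baseChange K).sha 2)] :
    ∃ e : ℕ, Nonempty (AddCommGroup.primaryComponent (W.baseChange K).sha 2 ≃+ ZMod (2 ^ e) × ZMod (2 ^ e)) ∧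
      Nat.card (AddCommGroup.primaryComponent (W.baseChange K).sha 2) = 4 ^ e :=
  exists_addEquiv_sha_primary_zmod_sq_of_cell W K (PoitouTateReduction.poitouTate_selmerStructure_duality_real_holds ℚ)
    (EP.forall_localEulerPoincareCharacteristic_adicCompletion ℚ) hΔ h4 hK hodd hH h2K hd Wd hWd hSel hL hrk

/-- **UNIQUE DESCENT OF A `σ₀`-INVARIANT `2`-SELMER CLASS OF `E_K` TO `Sel₂(E/ℚ)` ON THE K₄ CELL — UNCONDITIONAL** (p766389
`existsUnique_mem_selmerGroup_resTorsion_eq_of_cell` with `hPT`, `hEP` discharged).  BSD is NOT proved by this.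
[cite: Kramer1981, Thm. 1] [cite: GrossLMS1991, §5 (5.1), Prop. 6.2] [cite: MilneADT2006, Ch. I Thm. 4.10] -/
theorem existsUnique_mem_selmerGroup_resTorsion_eq_of_cell'
    (hΔ : W.Δ < 0) (h4 : Nat.card (W.selmerGroup 2) = 4) (hK : IsImaginaryQuadratic K) (hodd : Odd (discr K))
    (hH : SatisfiesHeegnerHypothesis (W.conductorNorm ℤ) K) (h2K : ((Ideal.span {(2 : ℤ)}).primesOver (𝓞 K)).ncard = 2)
    {ℓ₀ : ℕ} [Fact ℓ₀.Prime] (hd : discr K = -(ℓ₀ : ℤ))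
    (Wd : WeierstrassCurve ℚ) [Wd.IsElliptic] (hWd : ∃ C : VariableChange ℚ, C • W.quadraticTwist (discr K : ℚ) = Wd)
    (hSel : Nat.card (Wd.selmerGroup 2) = 2)
    (hL : ∀ P : (W.baseChange K).toAffine.Point, ((2 : ℕ) : ℤ) • P = 0 → P = 0)
    {σ₀ : K ≃ₐ[ℚ] K} (hσ₀ : σ₀ ≠ 1)
    {m : galH1Torsion (W.baseChange K) ((2 : ℕ) : ℤ)} (hm : m ∈ selmerGroup (W.baseChange K) ((2 : ℕ) : ℤ))
    (hσm : conjAct W σ₀ ((2 : ℕ) : ℤ) m = m) :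
    ∃! s : galH1Torsion W ((2 : ℕ) : ℤ), resTorsion W K ((2 : ℕ) : ℤ) s = m ∧ s ∈ W.selmerGroup ((2 : ℕ) : ℤ) :=
  existsUnique_mem_selmerGroup_resTorsion_eq_of_cell W K (PoitouTateReduction.poitouTate_selmerStructure_duality_real_holds ℚ)
    (EP.forall_localEulerPoincareCharacteristic_adicCompletion ℚ) hΔ h4 hK hodd hH h2K hd Wd hWd hSel hL hσ₀ hm hσm

/-- **THE CAPITULATING CLASS `s_y` OF `y_K/2^{M₀}` ON THE K₄ CELL — UNCONDITIONAL** (p768636 `existsUnique_resTorsion_eq_kummer_of_depth_pos_of_cell` with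
`hPT`, `hEP` discharged): habitat-type hypotheses (`r_an(E) = 0`, `ρ̄_{E,2}` onto, `d_K·Δ ∉ ℚ²`), a conductor-`1` datum `d₁` in McCallum's normal form
`2^{M₀} ∣ P(1)`, `2^{M₀+1} ∤ P(1)`; then `P₀, Q₀ ∈ E(K)` with `P₀ ↦ P(1)`, `2^{M₀}Q₀ = P₀`, `Q₀ ∉ 2E(K)`, and a UNIQUE `s_y ∈ H¹(ℚ, E[2])` with
`res_K s_y = κ₂(Q₀)`, `s_y ∈ Sel₂(E/ℚ)`, `s_y ≠ 0`.  BSD is NOT proved by this. [cite: GrossLMS1991, §4 (4.1), §5 Prop. 5.3] [cite: McCallumLMS1991, §5 Lemma 5.1]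
[cite: Kramer1981, Thm. 1] -/
theorem existsUnique_resTorsion_eq_kummer_of_depth_pos_of_cell' [NeZero (W.conductorNorm ℤ)]
    (hΔ : W.Δ < 0) (hs2 : W.HasSurjectiveModNGaloisRep 2) (h4 : Nat.card (W.selmerGroup 2) = 4)
    (hK : IsImaginaryQuadratic K) (hodd : Odd (discr K)) (hH : SatisfiesHeegnerHypothesis (W.conductorNorm ℤ) K)
    (h2K : ((Ideal.span {(2 : ℤ)}).primesOver (𝓞 K)).ncard = 2)
    {ℓ₀ : ℕ} [Fact ℓ₀.Prime] (hd : discr K = -(ℓ₀ : ℤ))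
    (Wd : WeierstrassCurve ℚ) [Wd.IsElliptic] (hWd : ∃ C : VariableChange ℚ, C • W.quadraticTwist (discr K : ℚ) = Wd)
    (hSel : Nat.card (Wd.selmerGroup 2) = 2) {σ₀ : K ≃ₐ[ℚ] K} (hσ₀ : σ₀ ≠ 1)
    (hr0 : W.analyticRank = 0) (hsq : ¬ IsSquare ((NumberField.discr K : ℚ) * W.Δ))
    (Dt : ModularParametrizationData W (W.conductorNorm ℤ)) (β : ℤ) (ι : K →+* ℂ) (d₁ : KolyvaginHeegnerData Dt β ι 1)
    {M₀ : ℕ} (hdiv : ∃ Q : (W.baseChange (ringClassField K ι 1)).toAffine.Point, ((2 ^ M₀ : ℕ) : ℤ) • Q = d₁.derivedPoint)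
    (hndiv : ¬ ∃ Q : (W.baseChange (ringClassField K ι 1)).toAffine.Point, ((2 ^ (M₀ + 1) : ℕ) : ℤ) • Q = d₁.derivedPoint)
    (hdiv₂ : ∀ X : geomPoints (W.baseChange K), ∃ Y : geomPoints (W.baseChange K), ((2 ^ 1 : ℕ) : ℤ) • Y = X) :
    ∃ P₀ Q₀ : (W.baseChange K).toAffine.Point, IsHeegnerPoint (W.conductorNorm ℤ) W K P₀ ∧
      Affine.Point.map (W' := W) (algebraMap K (ringClassField K ι 1)).toRatAlgHom P₀ = d₁.derivedPoint ∧
      ((2 ^ M₀ : ℕ) : ℤ) • Q₀ = P₀ ∧ (¬ ∃ R : (W.baseChange K).toAffine.Point, (2 : ℤ) • R = Q₀) ∧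
      (∃! s : galH1Torsion W ((2 ^ 1 : ℕ) : ℤ),
        resTorsion W K ((2 ^ 1 : ℕ) : ℤ) s = kummerMapTorsion (W.baseChange K) ((2 ^ 1 : ℕ) : ℤ) hdiv₂ Q₀ ∧
          s ∈ W.selmerGroup ((2 ^ 1 : ℕ) : ℤ)) ∧
      ∀ s : galH1Torsion W ((2 ^ 1 : ℕ) : ℤ),
        resTorsion W K ((2 ^ 1 : ℕ) : ℤ) s = kummerMapTorsion (W.baseChange K) ((2 ^ 1 : ℕ) : ℤ) hdiv₂ Q₀ → s ≠ 0 :=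
  existsUnique_resTorsion_eq_kummer_of_depth_pos_of_cell W K (PoitouTateReduction.poitouTate_selmerStructure_duality_real_holds ℚ)
    (EP.forall_localEulerPoincareCharacteristic_adicCompletion ℚ) hΔ hs2 h4 hK hodd hH h2K hd Wd hWd hSel hσ₀ hr0 hsq Dt β ι d₁ hdiv hndiv hdiv₂

/-! ## §2 The deep classes descend to `Sel₂(E/ℚ)` — modulo the ONE print fact Gross 3.7 (2) / Nekovář 4.9 -/

/-- **THE K₄′ READING AT EVERY KOLYVAGIN PRIME, MODULO GROSS 3.7 (2) ONLY.**  On the K₄ cell of crux 23491 (prime frame; `M₀ ≥ 1`), GIVEN the print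
fact `prop37_2_frobeniusCongruence` (Gross 1991 Prop. 3.7 (2) = Nekovář 2007 Prop. 4.9, the Eichler–Shimura congruence of the Heegner Euler system;
item 23091's signature): for EVERY Kolyvagin prime `ℓ` at `2` there is a datum `d` of conductor `1·ℓ`, McCallum-compatible with `d₁`, whose class
`c₁(ℓ)` is `res_K s` for a UNIQUE `s`, `s ∈ Sel₂(E/ℚ)`, and `c₁(ℓ) ≠ 0 ⟺ P(1·ℓ) ∉ 2E(K[1·ℓ])` — p767719 with Q2 := gk2-p2's
`GenusExact.kolyvaginRelationAtTwo_of_frobeniusCongruence`, `hPT`/`hEP` := the tree theorems.  CONDITIONAL on the print fact only.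
BSD is NOT proved by this. [cite: GrossLMS1991, Prop. 3.7 (2), §4 (4.4), §6 Prop. 6.2] [cite: Nekovar2007, Prop. 4.9] [cite: McCallumLMS1991, §4 Prop. 4.4, Cor. 4.5]
[cite: Kramer1981, Thm. 1] -/
theorem exists_compatible_datum_kolyvaginClass_two_descends_of_cell_of_frobeniusCongruence [NeZero (W.conductorNorm ℤ)]
    (h37 : prop37_2_frobeniusCongruence)
    (hcm : ¬ W.HasCM) (hΔ : W.Δ < 0) (hρ : ∀ m : ℕ, W.HasSurjectiveModNGaloisRep (2 ^ m : ℕ)) (hT : Odd W.tamagawaProduct)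
    (h4 : Nat.card (W.selmerGroup 2) = 4) (hK : IsImaginaryQuadratic K) (hodd : Odd (discr K)) (h3 : discr K ≠ -3)
    (hH : SatisfiesHeegnerHypothesis (W.conductorNorm ℤ) K) (h2K : ((Ideal.span {(2 : ℤ)}).primesOver (𝓞 K)).ncard = 2)
    {ℓ₀ : ℕ} [Fact ℓ₀.Prime] (hd : discr K = -(ℓ₀ : ℤ))
    (Wd : WeierstrassCurve ℚ) [Wd.IsElliptic] (hWd : ∃ C : VariableChange ℚ, C • W.quadraticTwist (discr K : ℚ) = Wd)
    (hSel : Nat.card (Wd.selmerGroup 2) = 2)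
    (hL : ∀ P : (W.baseChange K).toAffine.Point, ((2 : ℕ) : ℤ) • P = 0 → P = 0)
    {σ₀ : K ≃ₐ[ℚ] K} (hσ₀ : σ₀ ≠ 1)
    (Dt : ModularParametrizationData W (W.conductorNorm ℤ)) (β : ℤ) (ι : K →+* ℂ) (d₁ : KolyvaginHeegnerData Dt β ι 1)
    {M₀ : ℕ} (hM : 1 ≤ M₀)
    (hdiv : ∃ Q : (W.baseChange (ringClassField K ι 1)).toAffine.Point, ((2 ^ M₀ : ℕ) : ℤ) • Q = d₁.derivedPoint)
    {ℓ : ℕ} (hKoly : Zhang2014.IsKolyvaginPrime (W.conductorNorm ℤ) W K 2 ℓ) :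
    ∃ d : KolyvaginHeegnerData Dt β ι (1 * ℓ),
      (∀ s ∈ d₁.S, ∃ s' ∈ d.S, ∀ (x : ringClassField K ι 1) (x' : ringClassField K ι (1 * ℓ)),
          (x : ℂ) = x' → ((s' x' : ringClassField K ι (1 * ℓ)) : ℂ) = (s x : ℂ)) ∧
      (∀ (x : ringClassField K ι 1) (x' : ringClassField K ι (1 * ℓ)), (x : ℂ) = x' → d.emb x' = d₁.emb x) ∧
      (∃! s : galH1Torsion W ((2 ^ 1 : ℕ) : ℤ),
        resTorsion W K ((2 ^ 1 : ℕ) : ℤ) s = d.kolyvaginClass Nat.prime_two 1 ∧ s ∈ W.selmerGroup ((2 ^ 1 : ℕ) : ℤ)) ∧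
      (d.kolyvaginClass Nat.prime_two 1 ≠ 0 ↔
        ¬ ∃ Q : (W.baseChange (ringClassField K ι (1 * ℓ))).toAffine.Point, (2 : ℤ) • Q = d.derivedPoint) :=
  exists_compatible_datum_kolyvaginClass_two_descends_of_cell W K (GenusExact.kolyvaginRelationAtTwo_of_frobeniusCongruence h37)
    (PoitouTateReduction.poitouTate_selmerStructure_duality_real_holds ℚ) (EP.forall_localEulerPoincareCharacteristic_adicCompletion ℚ)
    hcm hΔ hρ hT h4 hK hodd h3 hH h2K hd Wd hWd hSel hL hσ₀ Dt β ι d₁ hM hdiv hKoly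

end Summit.BirchSwinnertonDyer.BirchSwinnertonDyer.Theorems.GenusSupplyNarrow.KFourCell

end
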